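import Summits.Ventures.HodgeRepro2.T5SU11ResolventL1Class
import Summits.Ventures.HodgeRepro2.T5SU11ResolventL2Schur
import Summits.Ventures.HodgeRepro2.T5SU11ResolventL2SchurWeighted
import Summits.Ventures.HodgeRepro2.T5SU11ResolventL2Sharp
import Summits.Ventures.HodgeRepro2.T5SU11ResolventSupNormWeighted
import Summits.Ventures.HodgeRepro2.T5SU11ResolventL1Weighted

/-!
# Summary XVI — the resolvent of the radial Laplacian on `L¹`, `L²` and the weighted sup-norm spaces: Schur's test
(rows 546–551), under uniform names

Throughout `μ = λ(λ − 2)`, `μ′ = λ′(λ′ − 2)`, `K_λ` the kernel of `G^I_λ = (L − μ)⁻¹`, and a *source of the class* is a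
continuous `g` on `(0, ∞)`, bounded on `(0, 1]`, with `|g(s)| ≤ C e^{−εs}` for large `s` at a rate `ε > 2 − λ`.

* `kernel_column_sum` — `∫_t |K_λ(t, s)| sinh 2t dt = 1/μ` (`λ > 2`; row 546);
* `l1_mem`, `l1_bound` — **`G^I_λ g sinh 2t ∈ L¹` and `∫ |G^I_λ g| sinh 2t ≤ (∫ |g| sinh 2s)/μ` for `λ > 2` and every source
  of the class with `|g| sinh 2s ∈ L¹`** (row 546);
* `cauchy_schwarz_weighted` — `(∫ w h)² ≤ (∫ w)(∫ w h²)` for a weight `w ≥ 0` (row 547);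
* `l2_mem_schur`, `l2_bound_schur` — **`sinh 2t (G^I_λ g)² ∈ L¹` and `∫ sinh 2t (G^I_λ g)² ≤ (∫ sinh 2s g²)/μ²` for `λ > 2`
  and every source of the class with `g² sinh 2s ∈ L¹`** — Schur's test (row 547);
* `kernel_row_sum_weighted` — `∫_s |K_λ(t, s)| φ_{λ′}(s) sinh 2s ds = φ_{λ′}(t)/(μ − μ′)` (`1 < λ′ < λ`; row 548);
* `l2_bound_weighted` — **`∫ sinh 2t (G^I_λ g)² ≤ (∫ sinh 2s g²)/(μ − μ′)²` for every `λ > 1`, `1 < λ′ < λ`** (row 548);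
* `l2_mem_all`, `l2_bound_sharp` — **`sinh 2t (G^I_λ g)² ∈ L¹` and `∫ sinh 2t (G^I_λ g)² ≤ (∫ sinh 2s g²)/((λ − 1)²)²` for
  EVERY `λ > 1` and every square-integrable source of the class** — the sharp constant `1/(λ − 1)²` (row 549);
* `linfty_bound_weighted`, `linfty_iterates_weighted`, `linfty_lipschitz_weighted`, `neumann_weighted` — **the weighted
  sup-norm theory for every `λ > 1`**: `|g| ≤ D φ_{λ′}` ⇒ `|G^I_λ g| ≤ D φ_{λ′}/(μ − μ′)`, `|(G^I_λ)ⁿ g| ≤ D φ_{λ′}/(μ − μ′)ⁿ`,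
  `|G^I_λ g − G^I_{λ₂} g| ≤ |μ − μ₂| D φ_{λ′}/((μ − μ′)(μ₂ − μ′))`, and the Neumann series converges uniformly in the
  weighted norm on `|μ − μ₂| < μ₂ − μ′` (row 550);
* `l1_mem_weighted`, `l1_bound_weighted` — **`G^I_λ g φ_{λ′} sinh 2t ∈ L¹` and `∫ |G^I_λ g| φ_{λ′} sinh 2t ≤
  (∫ |g| φ_{λ′} sinh 2s)/(μ − μ′)` for every `λ > 1`** (row 551).

Nothing is claimed about (N).

Blind lane: Mathlib + the HodgeRepro2 prefix only; no sorry; axioms ⊆ {propext, Classical.choice,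
Quot.sound}.
-/

namespace Summit.Ventures.HodgeRepro2.T5SU11RadialSummaryXVI

open Filter Topology MeasureTheory
open Set (Ioi Ioc)
open T5SU11Cartan T5SU11SphericalFunction T5SU11SphericalDecay T5SU11RadialGreenImproper T5SU11RadialGreenKernel
  T5SU11ResolventL1Class T5SU11ResolventL2Schur T5SU11ResolventL2SchurWeighted T5SU11ResolventL2Sharp
  T5SU11ResolventSupNormWeighted T5SU11ResolventL1Weighted

section measure

variable [MeasurableSpace Circle] [BorelSpace Circle]

/-- **The column sums of the kernel** `∫_{(0,∞)} |K_λ(t, s)| sinh 2t dt = 1/μ` (`λ > 2`; row 546). -/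
theorem kernel_column_sum {lam : ℝ} (h2 : 2 < lam) {s : ℝ} (hs : 0 < s) :
    ∫ t in Ioi 0, |sphGreenKernel lam t s| * Real.sinh (2 * t) = 1 / (lam * (lam - 2)) :=
  integral_abs_sphGreenKernel_mul_sinh_fst h2 hs

omit [MeasurableSpace Circle] [BorelSpace Circle] in
/-- **The weighted Cauchy–Schwarz inequality** `(∫ w h)² ≤ (∫ w)(∫ w h²)` (row 547). -/
theorem cauchy_schwarz_weighted {S : Set ℝ} (hS : MeasurableSet S) {w h : ℝ → ℝ}
    (hw0 : ∀ s ∈ S, 0 ≤ w s) (hw : IntegrableOn w S) (hwh : IntegrableOn (fun s => w s * h s) S)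
    (hwh2 : IntegrableOn (fun s => w s * h s ^ 2) S) :
    (∫ s in S, w s * h s) ^ 2 ≤ (∫ s in S, w s) * ∫ s in S, w s * h s ^ 2 :=
  sq_integral_le_integral_mul_integral_sq hS hw0 hw hwh hwh2

/-- **The weighted row sums of the kernel** `∫_{(0,∞)} |K_λ(t, s)| φ_{λ′}(s) sinh 2s ds = φ_{λ′}(t)/(μ − μ′)` (row 548). -/
theorem kernel_row_sum_weighted {lam lam' : ℝ} (hlam : 1 < lam) (h1 : 1 < lam') (h2 : lam' < lam) {t : ℝ} (ht : 0 < t) :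
    ∫ s in Ioi 0, |sphGreenKernel lam t s| * sph lam' (hyp s) * Real.sinh (2 * s)
      = sph lam' (hyp t) / (lam * (lam - 2) - lam' * (lam' - 2)) :=
  integral_abs_sphGreenKernel_mul_sph_snd hlam h1 h2 ht

variable {lam : ℝ} (hlam : 1 < lam) {g : ℝ → ℝ} (hg : ContinuousOn g (Ioi 0))
  {M : ℝ} (hM : ∀ s ∈ Ioc (0 : ℝ) 1, |g s| ≤ M) (hM0 : 0 ≤ M)
  {ε C s₀ : ℝ} (hε : 2 - lam < ε) (hC : ∀ s, s₀ ≤ s → |g s| ≤ C * Real.exp (-ε * s))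

include hg hM hM0 hε hC in
/-- **The resolvent preserves `L¹(sinh 2t dt)` for `λ > 2`** (row 546). -/
theorem l1_mem (h2 : 2 < lam) (hg1 : IntegrableOn (fun s => |g s| * Real.sinh (2 * s)) (Ioi 0)) :
    IntegrableOn (fun t => greenSolI (fun t => sph lam (hyp t)) (sphDecay lam) g t * Real.sinh (2 * t)) (Ioi 0) :=
  integrableOn_greenSolI_mul_sinh h2 hg hM hM0 hε hC hg1

include hg hM hM0 hε hC in
/-- **The `L¹` bound `∫ |G^I_λ g| sinh 2t ≤ (∫ |g| sinh 2s)/μ` for `λ > 2` and every integrable source of the class**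
(row 546). -/
theorem l1_bound (h2 : 2 < lam) (hg1 : IntegrableOn (fun s => |g s| * Real.sinh (2 * s)) (Ioi 0)) :
    ∫ t in Ioi 0, |greenSolI (fun t => sph lam (hyp t)) (sphDecay lam) g t| * Real.sinh (2 * t)
      ≤ (∫ s in Ioi 0, |g s| * Real.sinh (2 * s)) / (lam * (lam - 2)) :=
  integral_abs_greenSolI_mul_sinh_le_of_integrable h2 hg hM hM0 hε hC hg1

include hg hM hM0 hε hC in
/-- **The resolvent preserves `L²(sinh 2t dt)` for `λ > 2`** — Schur's test (row 547). -/
theorem l2_mem_schur (h2 : 2 < lam) (hg2 : IntegrableOn (fun s => Real.sinh (2 * s) * g s ^ 2) (Ioi 0)) :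
    IntegrableOn (fun t => Real.sinh (2 * t) * greenSolI (fun t => sph lam (hyp t)) (sphDecay lam) g t ^ 2) (Ioi 0) :=
  integrableOn_sinh_mul_greenSolI_sq_of_integrable h2 hg hM hM0 hε hC hg2

include hg hM hM0 hε hC in
/-- **The `L²` bound `∫ sinh 2t (G^I_λ g)² ≤ (∫ sinh 2s g²)/μ²` for `λ > 2` by Schur's test** (row 547). -/
theorem l2_bound_schur (h2 : 2 < lam) (hg2 : IntegrableOn (fun s => Real.sinh (2 * s) * g s ^ 2) (Ioi 0)) :
    ∫ t in Ioi 0, Real.sinh (2 * t) * greenSolI (fun t => sph lam (hyp t)) (sphDecay lam) g t ^ 2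
      ≤ (∫ s in Ioi 0, Real.sinh (2 * s) * g s ^ 2) / (lam * (lam - 2)) ^ 2 :=
  integral_sinh_mul_greenSolI_sq_le_of_integrable h2 hg hM hM0 hε hC hg2

include hlam hg hM hM0 hε hC in
/-- **The weighted Schur bound `∫ sinh 2t (G^I_λ g)² ≤ (∫ sinh 2s g²)/(μ − μ′)²` for every `λ > 1`, `1 < λ′ < λ`**
(row 548). -/
theorem l2_bound_weighted {lam' : ℝ} (h1 : 1 < lam') (h2 : lam' < lam)
    (hg2 : IntegrableOn (fun s => Real.sinh (2 * s) * g s ^ 2) (Ioi 0)) :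
    ∫ t in Ioi 0, Real.sinh (2 * t) * greenSolI (fun t => sph lam (hyp t)) (sphDecay lam) g t ^ 2
      ≤ (∫ s in Ioi 0, Real.sinh (2 * s) * g s ^ 2) / (lam * (lam - 2) - lam' * (lam' - 2)) ^ 2 :=
  integral_sinh_mul_greenSolI_sq_le_weighted hlam h1 h2 hg hM hM0 hε hC hg2

include hlam hg hM hM0 hε hC in
/-- **The resolvent preserves `L²(sinh 2t dt)` for every `λ > 1`** (row 549). -/
theorem l2_mem_all (hg2 : IntegrableOn (fun s => Real.sinh (2 * s) * g s ^ 2) (Ioi 0)) :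
    IntegrableOn (fun t => Real.sinh (2 * t) * greenSolI (fun t => sph lam (hyp t)) (sphDecay lam) g t ^ 2) (Ioi 0) :=
  integrableOn_sinh_mul_greenSolI_sq_all hlam hg hM hM0 hε hC hg2

include hlam hg hM hM0 hε hC in
/-- **THE SHARP `L²` BOUND `∫ sinh 2t (G^I_λ g)² ≤ (∫ sinh 2s g²)/((λ − 1)²)²` for EVERY `λ > 1` and every square-integrable
source of the class** (row 549). -/
theorem l2_bound_sharp (hg2 : IntegrableOn (fun s => Real.sinh (2 * s) * g s ^ 2) (Ioi 0)) :
    ∫ t in Ioi 0, Real.sinh (2 * t) * greenSolI (fun t => sph lam (hyp t)) (sphDecay lam) g t ^ 2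
      ≤ (∫ s in Ioi 0, Real.sinh (2 * s) * g s ^ 2) / ((lam - 1) ^ 2) ^ 2 :=
  integral_sinh_mul_greenSolI_sq_le_sharp hlam hg hM hM0 hε hC hg2

include hlam hg hM hM0 hε hC in
/-- **The weighted `L^∞` bound `|G^I_λ g(t)| ≤ D φ_{λ′}(t)/(μ − μ′)` for `|g| ≤ D φ_{λ′}`, every `λ > 1`** (row 550). -/
theorem linfty_bound_weighted {lam' : ℝ} (h1 : 1 < lam') (h2 : lam' < lam)
    {D : ℝ} (hD : ∀ s, 0 < s → |g s| ≤ D * sph lam' (hyp s)) {t : ℝ} (ht : 0 < t) :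
    |greenSolI (fun t => sph lam (hyp t)) (sphDecay lam) g t|
      ≤ D * sph lam' (hyp t) / (lam * (lam - 2) - lam' * (lam' - 2)) :=
  abs_greenSolI_le_mul_sph hlam h1 h2 hg hM hM0 hε hC hD ht

include hlam hg hM hM0 hε hC in
/-- **The iterates in the weighted sup-norm** `|(G^I_λ)ⁿ g(t)| ≤ D φ_{λ′}(t)/(μ − μ′)ⁿ` (row 550). -/
theorem linfty_iterates_weighted {lam' : ℝ} (h1 : 1 < lam') (h2 : lam' < lam)
    {D : ℝ} (hD : ∀ s, 0 < s → |g s| ≤ D * sph lam' (hyp s)) (n : ℕ) :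
    ∀ t, 0 < t → |((greenSolI (fun t => sph lam (hyp t)) (sphDecay lam))^[n] g) t|
      ≤ D * sph lam' (hyp t) / (lam * (lam - 2) - lam' * (lam' - 2)) ^ n :=
  abs_iterate_le_mul_sph hlam h1 h2 hg hM hM0 hε hC hD n

include hg hM hM0 hε hC in
/-- **The resolvent is Lipschitz in `μ` in the weighted sup-norm** (row 550). -/
theorem linfty_lipschitz_weighted {lam' lam₂ : ℝ} (h1 : 1 < lam') (h2 : lam' < lam) (h2' : lam' < lam₂)
    (hε₂ : 2 - lam₂ < ε) {D : ℝ} (hD : ∀ s, 0 < s → |g s| ≤ D * sph lam' (hyp s)) {t : ℝ} (ht : 0 < t) :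
    |greenSolI (fun t => sph lam (hyp t)) (sphDecay lam) g t - greenSolI (fun t => sph lam₂ (hyp t)) (sphDecay lam₂) g t|
      ≤ |lam * (lam - 2) - lam₂ * (lam₂ - 2)| * D * sph lam' (hyp t)
        / ((lam * (lam - 2) - lam' * (lam' - 2)) * (lam₂ * (lam₂ - 2) - lam' * (lam' - 2))) :=
  abs_greenSolI_sub_le_mul_sph h1 h2 h2' hg hM hM0 hε hε₂ hC hD ht

include hg hM hM0 hε hC in
/-- **The Neumann series converges in the weighted sup-norm on `|μ − μ₂| < μ₂ − μ′`** (row 550). -/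
theorem neumann_weighted {lam' lam₂ : ℝ} (h1 : 1 < lam') (h2 : lam' < lam) (h2' : lam' < lam₂)
    (hε₂ : 2 - lam₂ < ε) {D : ℝ} (hD : ∀ s, 0 < s → |g s| ≤ D * sph lam' (hyp s))
    (hq : |lam * (lam - 2) - lam₂ * (lam₂ - 2)| < lam₂ * (lam₂ - 2) - lam' * (lam' - 2)) :
    Tendsto (fun n : ℕ => (|lam * (lam - 2) - lam₂ * (lam₂ - 2)| / (lam₂ * (lam₂ - 2) - lam' * (lam' - 2))) ^ (n + 1)
      * (D / (lam * (lam - 2) - lam' * (lam' - 2)))) atTop (𝓝 0) ∧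
    ∀ n : ℕ, ∀ t, 0 < t → |greenSolI (fun t => sph lam (hyp t)) (sphDecay lam) g t
        - ∑ k ∈ Finset.range (n + 1), (lam * (lam - 2) - lam₂ * (lam₂ - 2)) ^ k
          * (greenSolI (fun t => sph lam₂ (hyp t)) (sphDecay lam₂))^[k + 1] g t|
      ≤ ((|lam * (lam - 2) - lam₂ * (lam₂ - 2)| / (lam₂ * (lam₂ - 2) - lam' * (lam' - 2))) ^ (n + 1)
        * (D / (lam * (lam - 2) - lam' * (lam' - 2)))) * sph lam' (hyp t) :=
  tendsto_neumann_weighted h1 h2 h2' hg hM hM0 hε hε₂ hC hD hq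

include hlam hg hM hM0 hε hC in
/-- **The resolvent preserves `L¹(φ_{λ′} sinh 2t dt)` for every `λ > 1`** (row 551). -/
theorem l1_mem_weighted {lam' : ℝ} (h1 : 1 < lam') (h2 : lam' < lam)
    (hg1 : IntegrableOn (fun s => |g s| * sph lam' (hyp s) * Real.sinh (2 * s)) (Ioi 0)) :
    IntegrableOn (fun t => greenSolI (fun t => sph lam (hyp t)) (sphDecay lam) g t * sph lam' (hyp t)
      * Real.sinh (2 * t)) (Ioi 0) :=
  integrableOn_greenSolI_mul_sph_mul_sinh hlam h1 h2 hg hM hM0 hε hC hg1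

include hlam hg hM hM0 hε hC in
/-- **The weighted `L¹` bound `∫ |G^I_λ g| φ_{λ′} sinh 2t ≤ (∫ |g| φ_{λ′} sinh 2s)/(μ − μ′)` for every `λ > 1`** (row 551). -/
theorem l1_bound_weighted {lam' : ℝ} (h1 : 1 < lam') (h2 : lam' < lam)
    (hg1 : IntegrableOn (fun s => |g s| * sph lam' (hyp s) * Real.sinh (2 * s)) (Ioi 0)) :
    ∫ t in Ioi 0, |greenSolI (fun t => sph lam (hyp t)) (sphDecay lam) g t| * sph lam' (hyp t) * Real.sinh (2 * t)
      ≤ (∫ s in Ioi 0, |g s| * sph lam' (hyp s) * Real.sinh (2 * s)) / (lam * (lam - 2) - lam' * (lam' - 2)) :=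
  integral_abs_greenSolI_mul_sph_mul_sinh_le hlam h1 h2 hg hM hM0 hε hC hg1

end measure

end Summit.Ventures.HodgeRepro2.T5SU11RadialSummaryXVI
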